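import Literature.NumberTheory.EllipticCurves.ModularCurve
import Literature.NumberTheory.EllipticCurves.QuadraticTwist
import Literature.NumberTheory.EllipticCurves.GlobalMinimalModel
import Literature.NumberTheory.EllipticCurves.GaloisAction
import Literature.NumberTheory.EllipticCurves.KellerYin2024.PotentiallyGoodOrdinaryPConverse
import Literature.NumberTheory.DiophantineGeometry.Conductor
import HarnessLib
import HarnessLib.Audit.Tags

/-!
# Candidate E-imc-9b: the FLIP CRITERION — when does `X₀`-optimality commute with the ramified twist at
# `p ≥ 5`? (`RamifiedTwistFlipCriterion p`, an iff DECISION LAW)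
# — cell `bsd-f2-manin` (D-0131 (3) frontier: the Manin constant at additive primes). `@[conjecture]`
# leaf (NOTHING asserted; definition only; proved edge to E-imc-9a in `OrdinaryRamifiedTwistEdges.lean`).

HONEST FRAMING. LENS = Iwasawa-main-conjecture / Hida-family reading (planner-of-record `bsd-f2-manin-imc`
g2, HOME `run/shared/lean/pub/bsd-f2-manin/MEMO-imc.md` §10), Prop VERBATIM from HOME/imc/Sketch-imc-g2.lean
v3 (sha16 67903f81d6ef5b7a) with `pStar` / `IsLatticeOptimal` inlined as in the landed leaves. `W` = the
`X₀`-optimal curve of its class (globally minimal model, optimal datum `D` at the conductor level, `p² ∣ N`),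
`W′ = C • (W ⊗ χ_{p*})` globally minimal with the SAME conductor.

THIS ROW (E-imc-9b): `W′` is `X₀`-optimal (carries a datum with the lattice clause) **iff** `W` is
potentially good ordinary at `p` OR `E[p]` is irreducible; equivalently the optimal curves of the two classes
FAIL to be twists of each other exactly in the supercuspidal cells with a rational `p`-isogeny
(`p ∈ {5, 7, 11, 17, 19, 43, 67, 163}` only). Subsumes E-imc-9a (⇐, principal-series branch) and the
irreducible branch of the landed E-imc-3b; the ⇒ direction (supercuspidal ∧ rational `p`-isogeny ⇒ flip) is
new. BC5 WITNESS (memo §10; refuter-1 engine N < 5·10⁵, same-conductor directed rows, `p ≥ 5`): principal-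
series cells 170 216 / 170 216 commute (1 076 with a rational `p`-isogeny); supercuspidal cells: `E[p]`
irreducible ⇒ commute (all), rational `p`-isogeny ⇒ FLIP 1 758 / 1 758 (+ 135 CM self-twists outside the
binder); ⇐ 0 exceptions. Refuter verdicts: REF1 **SURVIVES** 2026-08-27T16:22Z (HOME/REFUTER-ref1.md §R5:
rc 0, BC7 CLEAN, HOME/ref1-C9-imc-g2.lean); REF2 (HOME/REFUTER-ref2.md, v3 §C‴, revised 16:26Z):
NOT-IN-PRINT; the FLIP direction REDUCES to [MH′] «the `X₀`-optimal curve is the lower end of its rational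
`p`-isogenies ⟺ `c(E′) = c(E₀)`» (table-true 4 030 / 4 030 `p`-edges `p ≥ 5`, `p² ∣ N`; NOT in print) ∧
Dokchitser–Dokchitser 2015 Cor. 8 (a `p`-isogeny swaps T ↔ T* iff potentially supersingular) ∧ Pal 2012 §2.4.
The support S-imc-9c «twisting by `χ_{p*}` keeps the conductor in tame potentially-good cells with `e ≥ 3`»
is in print and is NOT vendored here; the edge 9b ⟹ 9a takes it as an explicit hypothesis.
-/

noncomputable section

open scoped MatrixGroups ModularForm

open CongruenceSubgroup WeierstrassCurve
  Literature.NumberTheory.EllipticCurves Literature.NumberTheory.EllipticCurves.ModularForms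

namespace Summit.BirchSwinnertonDyer.Rank1Residual.ManinAdditive

/-- **Candidate E-imc-9b `RamifiedTwistFlipCriterion p` (cell bsd-f2-manin; a DECISION LAW, NOT in print,
nothing asserted):** for a prime `p ≥ 5`, a globally minimal `W` with `p² ∣ N = W.conductorNorm ℤ` carrying
an `X₀(N)`-optimal datum `D` (lattice clause `Λ_W = c·Λ_f`), and a globally minimal `W′ = C • (W ⊗ χ_{p*})`
with the same conductor: `W′` carries an `X₀`-optimal datum at its conductor level **iff** `W` has
potentially good ordinary reduction at `p` or the mod-`p` representation of `W` is irreducible.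
[cite: DokchitserLocalInvariants2015, Cor. 8 (arXiv:1208.5519 p. 6: a p-isogeny keeps the Kodaira type iff
the reduction is potentially ordinary — the mechanism of the flip; the optimality criterion itself is NOT in
print, cell bsd-f2-manin MEMO-imc.md §10, E-imc-9b)] -/
@[conjecture] def RamifiedTwistFlipCriterion (p : ℕ) : Prop :=
  ∀ (W W' : WeierstrassCurve ℚ) [W.IsElliptic] [W.IsGloballyMinimal] [W'.IsElliptic]
    [W'.IsGloballyMinimal] [NeZero (W.conductorNorm ℤ)] [NeZero (W'.conductorNorm ℤ)]
    (D : ModularParametrizationData W (W.conductorNorm ℤ)) (C : WeierstrassCurve.VariableChange ℚ),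
    p.Prime → 5 ≤ p → p ^ 2 ∣ W.conductorNorm ℤ →
    (∀ z ∈ D.L.lattice, ∃ w ∈ periodLattice D.f, z = D.c * w) →
    C • W.quadraticTwist ((((-1 : ℤ) ^ (p / 2) * p : ℤ) : ℚ)) = W' →
    W'.conductorNorm ℤ = W.conductorNorm ℤ →
    ((∃ D' : ModularParametrizationData W' (W'.conductorNorm ℤ),
        ∀ z ∈ D'.L.lattice, ∃ w ∈ periodLattice D'.f, z = D'.c * w) ↔
      (W.HasPotentiallyGoodOrdinaryReductionAtPrime p ∨ W.HasIrreducibleModPGaloisRep p))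

end Summit.BirchSwinnertonDyer.Rank1Residual.ManinAdditive

end
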